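import Summits.CriticalPhenomena.PercolationContinuityZ3.Theorems.PercNearOneGluingNoHeavyQuantHairCombMixture
import HarnessLib

/-!
# QUANT lane R8, FAR on trees beyond block-combs: THE HAIR–CHERRY-COMB ROW — FAR at every layer for every block-comb decorated with unit
# cherries, unit two-relay hairs AND light two-class hairs of any class sizes, under `EN > 2j` (canonical stemmed model)

builds on p205010 (kernel theorem, internal audit signed; external expert review pending)

Support file (`--supports stmt-CriticalPhenomena-4575`), QUANT lane seat prim-quant-p1 (gen 10); memo `run/shared/lean/prim/quant/P1-SURPLUS.md` §21.
Theorems only (local notation of `…QuantCherryCombModels`), no sorries, standard axioms.  Extends `Quant.CherryComb.tail_ge_of_cherryComb`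
(`…QuantCherryCombRow.lean`, same seat) by a second kind of admissible leaf: the induction on the number of leaves now uses the unit-cherry step
`min_tail_detach_glue_le_tail` OR the light-hair step `min_tail_top_glue_le_tail` (`…QuantHairCombMixture.lean`).

* **`Quant.CherryComb.tail_ge_of_hairCherryComb` — THE HAIR–CHERRY-COMB ROW.**  Every leaf `k` is EITHER in a unit cherry (stem of size `0`, one
  partner leaf of the same size) OR the unique, live leaf of a LIGHT HAIR (stem of size `p > 0`, `g(st k)·(p + g k·a k) ≤ p`); `x ≤` every live
  marginal; `2j < EN` ⟹ `x ≤ TAILst`.  Heavy hairs with `p = a k` are unit cherries (gate-`1` leaf), so among two-class hairs exactly the HEAVY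
  UNEQUAL ones are excluded — and those lie outside every mixture of block-comb laws (P1-SURPLUS §21.3–21.4).
[this work]; mixture principle: prim-quant-census-1 GENERAL-ROW-G13 §7 (T4) (this lane); product weights [cite: Grimmett1999, §1.3 p. 10].
-/

namespace Summit.CriticalPhenomena.PercolationContinuityZ3.Theorems

namespace Quant

namespace CherryComb

open Finset

variable {κ : Type*} [Fintype κ] [DecidableEq κ]

/-- product-Bernoulli weight of the set `S` of open pieces -/
local notation3 "wt[" g ", " S "]" => ∏ k, (if k ∈ (S : Finset κ) then (g : κ → ℝ) k else 1 - (g : κ → ℝ) k)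

/-- probability that the chain `q` of length `D` is open exactly to depth `i` -/
local notation3 "pd[" D ", " q ", " i "]" =>
  (∏ i' ∈ Finset.range (i : ℕ), (q : ℕ → ℝ) i') * (if (i : ℕ) < (D : ℕ) then 1 - (q : ℕ → ℝ) i else 1)

/-- mass counted at depth `i` in configuration `S` of the STEMMED model -/
local notation3 "massSt[" lv ", " a ", " st ", " i ", " S "]" =>
  ∑ k ∈ (S : Finset κ).filter (fun k => (lv : κ → ℕ) k ≤ (i : ℕ) ∧ (st : κ → κ) k ∈ (S : Finset κ)), ((a : κ → ℕ) k : ℕ)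

/-- the stemmed tail `P(N ≥ j+1)` -/
local notation3 "TAILst[" D ", " q ", " lv ", " a ", " g ", " st ", " j "]" =>
  ∑ i ∈ Finset.range ((D : ℕ) + 1), pd[D, q, i] *
    ∑ S : Finset κ, wt[g, S] * (if (j : ℕ) + 1 ≤ massSt[lv, a, st, i, S] then (1 : ℝ) else 0)

omit [DecidableEq κ] in
/-- Two sums over `κ` agree if the summands agree off two distinct pieces and the two exceptional summands have the same total. -/
theorem sum_congr_off_two (f f' : κ → ℝ) (k₁ k₂ : κ) (h12 : k₁ ≠ k₂) (hoff : ∀ k, k ≠ k₁ → k ≠ k₂ → f' k = f k)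
    (h2 : f' k₁ + f' k₂ = f k₁ + f k₂) : ∑ k, f' k = ∑ k, f k := by
  classical
  have m2 : k₂ ∈ (Finset.univ : Finset κ).erase k₁ := Finset.mem_erase.2 ⟨h12.symm, Finset.mem_univ _⟩
  have hS : ∀ h : κ → ℝ, ∑ k, h k = h k₁ + h k₂ + ∑ k ∈ ((Finset.univ : Finset κ).erase k₁).erase k₂, h k := by
    intro h
    rw [← Finset.add_sum_erase _ _ (Finset.mem_univ k₁), ← Finset.add_sum_erase _ _ m2]
    ring
  rw [hS f', hS f, h2, Finset.sum_congr rfl fun k hk => hoff k ?_ ?_]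
  · exact fun h => by simp [h] at hk
  · exact fun h => by simp [h] at hk

/-- The hair–cherry-comb row by induction on (a bound for) the number of leaves. [this work] -/
theorem tail_ge_of_hairCherryComb_aux (D : ℕ) (q : ℕ → ℝ) (hq : ∀ i, 0 ≤ q i ∧ q i ≤ 1) (lv : κ → ℕ) (j : ℕ) (x : ℝ) :
    ∀ (n : ℕ) (a : κ → ℕ) (g : κ → ℝ) (st : κ → κ),
      (Finset.univ.filter fun k => st k ≠ k).card ≤ n →
      (∀ k, 0 ≤ g k ∧ g k ≤ 1) → (∀ k, st (st k) = st k) → (∀ k, lv (st k) = lv k) →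
      (∀ k, st k ≠ k →
        (a (st k) = 0 ∧ ∃ k', k' ≠ k ∧ k' ≠ st k ∧ st k' = st k ∧ a k' = a k ∧
          ∀ k'', st k'' = st k → k'' = st k ∨ k'' = k ∨ k'' = k') ∨
        (0 < a (st k) ∧ 0 < a k ∧ g (st k) * (a (st k) + g k * a k) ≤ a (st k) ∧ ∀ k'', st k'' = st k → k'' = st k ∨ k'' = k)) →
      (∀ k, 0 < a k → lv k ≤ D) →
      (∀ k, 0 < a k → x ≤ (∏ i ∈ Finset.range (lv k), q i) * (if st k = k then g k else g (st k) * g k)) →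
      (2 * j : ℝ) < ∑ k, (a k : ℝ) * ((∏ i ∈ Finset.range (lv k), q i) * (if st k = k then g k else g (st k) * g k)) →
      x ≤ TAILst[D, q, lv, a, g, st, j] := by
  intro n
  induction n with
  | zero =>
    intro a g st hcard hg _ _ _ hlv hx hmean
    have hall : ∀ k, st k = k := by
      intro k
      by_contra h
      have hk : k ∈ Finset.univ.filter fun k => st k ≠ k := Finset.mem_filter.2 ⟨Finset.mem_univ _, h⟩
      have := Finset.card_pos.2 ⟨k, hk⟩
      omega
    exact tail_ge_of_noLeaf D q hq lv a g hg st hall j hlv x hx hmean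
  | succ n ih =>
    intro a g st hcard hg hstem hlvst hunit hlv hx hmean
    by_cases hall : ∀ k, st k = k
    · exact tail_ge_of_noLeaf D q hq lv a g hg st hall j hlv x hx hmean
    push Not at hall
    obtain ⟨ℓ₁, hℓ₁⟩ := hall
    obtain ⟨s₀, hst1⟩ : ∃ s₀, st ℓ₁ = s₀ := ⟨_, rfl⟩
    have h1 : s₀ ≠ ℓ₁ := fun h => hℓ₁ (hst1.trans h)
    have hst0 : st s₀ = s₀ := by rw [← hst1]; exact hstem ℓ₁
    have hnl1 : ∀ k, st k ≠ ℓ₁ := fun k h => by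
      have := hstem k; rw [h] at this; exact hℓ₁ this
    have hlv1 : lv ℓ₁ = lv s₀ := by rw [← hst1]; exact (hlvst ℓ₁).symm
    have hg0 := hg s₀
    have hg1 := hg ℓ₁
    have hxℓ₁ : 0 < a ℓ₁ → x ≤ (∏ i ∈ Finset.range (lv s₀), q i) * (g s₀ * g ℓ₁) := fun h => by
      have := hx ℓ₁ h; rwa [if_neg hℓ₁, hst1, hlv1] at this
    -- the number of leaves drops when `ℓ₁` (and possibly `ℓ₂`) is detached
    have hcard_of : ∀ st' : κ → κ, st' ℓ₁ = ℓ₁ → (∀ k, k ≠ ℓ₁ → st' k ≠ k → st k ≠ k) →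
        (Finset.univ.filter fun k => st' k ≠ k).card ≤ n := by
      intro st' h1' ho
      have hsub : (Finset.univ.filter fun k => st' k ≠ k) ⊆ (Finset.univ.filter fun k => st k ≠ k).erase ℓ₁ := by
        intro k hk
        rw [Finset.mem_filter] at hk
        have hk1 : k ≠ ℓ₁ := fun h => hk.2 (by rw [h, h1'])
        rw [Finset.mem_erase, Finset.mem_filter]
        exact ⟨hk1, Finset.mem_univ _, ho k hk1 hk.2⟩
      have hmem : ℓ₁ ∈ Finset.univ.filter (fun k => st k ≠ k) := Finset.mem_filter.2 ⟨Finset.mem_univ _, hℓ₁⟩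
      have h' := Finset.card_le_card hsub
      rw [Finset.card_erase_of_mem hmem] at h'
      omega
    rcases hunit ℓ₁ hℓ₁ with ⟨ha0, ℓ₂, h21, h2s, hst2, ha21, hfib⟩ | ⟨hp, hr, hlight, hfib⟩
    · ------------------------------------------------------------------ unit cherry (s₀; ℓ₁, ℓ₂)
      rw [hst1] at ha0 h2s hst2 hfib
      obtain ⟨m, ha1⟩ : ∃ m, a ℓ₁ = m := ⟨_, rfl⟩
      have ha2 : a ℓ₂ = m := ha21.trans ha1
      have h12 : ℓ₁ ≠ ℓ₂ := h21.symm
      have h2 : s₀ ≠ ℓ₂ := h2s.symm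
      have hnl2 : ∀ k, st k ≠ ℓ₂ := fun k h => by
        have := hstem k; rw [h, hst2] at this; exact h2 this
      have hlv2 : lv ℓ₂ = lv s₀ := by rw [← hst2]; exact (hlvst ℓ₂).symm
      have hg2 := hg ℓ₂
      have hxℓ₂ : 0 < a ℓ₂ → x ≤ (∏ i ∈ Finset.range (lv s₀), q i) * (g s₀ * g ℓ₂) := fun h => by
        have := hx ℓ₂ h; rwa [if_neg (fun h' => h2 (hst2.symm.trans h')), hst2, hlv2] at this
      have hoff : ∀ k, k ≠ ℓ₁ → k ≠ ℓ₂ → k ≠ s₀ → st k ≠ s₀ := fun k hk1 hk2 hk0 h => by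
        rcases hfib k h with h' | h' | h'
        exacts [hk0 h', hk1 h', hk2 h']
      have hstep := min_tail_detach_glue_le_tail D q lv a g st s₀ ℓ₁ ℓ₂ m h12 h1 h2 hst0 hst1 hst2 hfib hnl1 hnl2 ha0 ha1 ha2
        hlv1 hlv2 hg0 hg1 hg2 j
      refine le_trans (le_min ?_ ?_) hstep
      all_goals
        obtain ⟨hstU1, hstU2, hstU0, hstUo, -, -, -⟩ := detach_facts st s₀ ℓ₁ ℓ₂ h12 h1 h2 hst0 hfib hnl1 hnl2
        set stU := Function.update (Function.update st ℓ₁ ℓ₁) ℓ₂ ℓ₂ with hstU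
        have hcardU : (Finset.univ.filter fun k => stU k ≠ k).card ≤ n :=
          hcard_of stU hstU1 fun k hk1 hk => by
            by_cases hk2 : k = ℓ₂
            · rw [hk2, hstU2] at hk; exact absurd rfl hk
            · rwa [hstUo k hk1 hk2] at hk
        have hstemU : ∀ k, stU (stU k) = stU k := fun k => by
          by_cases hk1 : k = ℓ₁; · rw [hk1, hstU1, hstU1]
          by_cases hk2 : k = ℓ₂; · rw [hk2, hstU2, hstU2]
          rw [hstUo k hk1 hk2, hstUo (st k) (hnl1 k) (hnl2 k), hstem k]
        have hlvstU : ∀ k, lv (stU k) = lv k := fun k => by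
          by_cases hk1 : k = ℓ₁; · rw [hk1, hstU1]
          by_cases hk2 : k = ℓ₂; · rw [hk2, hstU2]
          rw [hstUo k hk1 hk2]; exact hlvst k
        -- a remaining leaf, its stem and its fibre avoid the cherry
        have hleafU : ∀ k, stU k ≠ k → k ≠ ℓ₁ ∧ k ≠ ℓ₂ ∧ k ≠ s₀ ∧ stU k = st k ∧ st k ≠ k ∧ st k ≠ s₀ ∧
            (∀ k'', stU k'' = st k → k'' ≠ ℓ₁ ∧ k'' ≠ ℓ₂ ∧ st k'' = st k) := by
          intro k hk
          have hk1 : k ≠ ℓ₁ := fun h => hk (by rw [h, hstU1])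
          have hk2 : k ≠ ℓ₂ := fun h => hk (by rw [h, hstU2])
          have hsk : stU k = st k := hstUo k hk1 hk2
          have hstk : st k ≠ k := fun h => hk (by rw [hsk, h])
          have hk0 : k ≠ s₀ := fun h => hstk (by rw [h, hst0])
          refine ⟨hk1, hk2, hk0, hsk, hstk, hoff k hk1 hk2 hk0, fun k'' hk'' => ?_⟩
          have hk''1 : k'' ≠ ℓ₁ := fun h => hnl1 k (by rw [← hk'', h, hstU1])
          have hk''2 : k'' ≠ ℓ₂ := fun h => hnl2 k (by rw [← hk'', h, hstU2])
          exact ⟨hk''1, hk''2, by rwa [hstUo k'' hk''1 hk''2] at hk''⟩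
      · -- model `U`
        set gU := Function.update (Function.update g ℓ₁ (g s₀ * g ℓ₁)) ℓ₂ (g s₀ * g ℓ₂) with hgU
        have hgU1 : gU ℓ₁ = g s₀ * g ℓ₁ := by rw [hgU, Function.update_of_ne h12, Function.update_self]
        have hgU2 : gU ℓ₂ = g s₀ * g ℓ₂ := by rw [hgU, Function.update_self]
        have hgUo : ∀ k, k ≠ ℓ₁ → k ≠ ℓ₂ → gU k = g k := fun k hk1 hk2 => by
          rw [hgU, Function.update_of_ne hk2, Function.update_of_ne hk1]
        have hgU' : ∀ k, 0 ≤ gU k ∧ gU k ≤ 1 := fun k => by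
          by_cases hk1 : k = ℓ₁; · rw [hk1, hgU1]; exact ⟨mul_nonneg hg0.1 hg1.1, mul_le_one₀ hg0.2 hg1.1 hg1.2⟩
          by_cases hk2 : k = ℓ₂; · rw [hk2, hgU2]; exact ⟨mul_nonneg hg0.1 hg2.1, mul_le_one₀ hg0.2 hg2.1 hg2.2⟩
          rw [hgUo k hk1 hk2]; exact hg k
        have hfac : ∀ k, (if stU k = k then gU k else gU (stU k) * gU k) = (if st k = k then g k else g (st k) * g k) := by
          intro k
          by_cases hk1 : k = ℓ₁
          · rw [hk1, if_pos hstU1, if_neg (fun h => hℓ₁ h), hgU1, hst1]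
          by_cases hk2 : k = ℓ₂
          · rw [hk2, if_pos hstU2, if_neg (fun h => h2 (hst2.symm.trans h)), hgU2, hst2]
          rw [hstUo k hk1 hk2, hgUo k hk1 hk2]
          by_cases hsk : st k = k
          · rw [if_pos hsk, if_pos hsk]
          · rw [if_neg hsk, if_neg hsk, hgUo (st k) (hnl1 k) (hnl2 k)]
        refine ih a gU stU hcardU hgU' hstemU hlvstU (fun k hk => ?_) hlv (fun k hk => by rw [hfac k]; exact hx k hk)
          (by rw [Finset.sum_congr rfl fun k _ => by rw [hfac k]]; exact hmean)
        obtain ⟨hk1, hk2, hk0, hsk, hstk, hsk0, hfibU⟩ := hleafU k hk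
        rw [hsk, hgUo k hk1 hk2, hgUo (st k) (hnl1 k) (hnl2 k)]
        rcases hunit k hstk with ⟨ha0', k', hk'k, hk's, hst', ha', hfib'⟩ | ⟨hp', hak, hl', hfib'⟩
        · refine Or.inl ⟨ha0', k', hk'k, hk's, ?_, ha', fun k'' hk'' => hfib' k'' (hfibU k'' hk'').2.2⟩
          have hk'1 : k' ≠ ℓ₁ := fun h => hsk0 (by rw [← hst', h, hst1])
          have hk'2 : k' ≠ ℓ₂ := fun h => hsk0 (by rw [← hst', h, hst2])
          rw [hstUo k' hk'1 hk'2, hst']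
        · exact Or.inr ⟨hp', hak, hl', fun k'' hk'' => hfib' k'' (hfibU k'' hk'').2.2⟩
      · -- model `G`
        set aG := Function.update (Function.update (Function.update a s₀ (2 * m)) ℓ₁ 0) ℓ₂ 0 with haG
        set gG := Function.update g s₀ (g s₀ * (g ℓ₁ + g ℓ₂) / 2) with hgG
        have hgG0 : gG s₀ = g s₀ * (g ℓ₁ + g ℓ₂) / 2 := by rw [hgG, Function.update_self]
        have hgGo : ∀ k, k ≠ s₀ → gG k = g k := fun k hk => by rw [hgG, Function.update_of_ne hk]
        have haG0 : aG s₀ = 2 * m := by rw [haG, Function.update_of_ne h2, Function.update_of_ne h1, Function.update_self]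
        have haG1 : aG ℓ₁ = 0 := by rw [haG, Function.update_of_ne h12, Function.update_self]
        have haG2 : aG ℓ₂ = 0 := by rw [haG, Function.update_self]
        have haGo : ∀ k, k ≠ ℓ₁ → k ≠ ℓ₂ → k ≠ s₀ → aG k = a k := fun k hk1 hk2 hk0 => by
          rw [haG, Function.update_of_ne hk2, Function.update_of_ne hk1, Function.update_of_ne hk0]
        have hgG' : ∀ k, 0 ≤ gG k ∧ gG k ≤ 1 := by
          intro k
          by_cases hk0 : k = s₀
          · rw [hk0, hgG0]
            exact ⟨by nlinarith [hg0.1, hg1.1, hg2.1], by nlinarith [hg0.1, hg0.2, hg1.2, hg2.2, hg1.1, hg2.1]⟩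
          rw [hgGo k hk0]; exact hg k
        have hfac : ∀ k, k ≠ ℓ₁ → k ≠ ℓ₂ → k ≠ s₀ →
            (if stU k = k then gG k else gG (stU k) * gG k) = (if st k = k then g k else g (st k) * g k) := by
          intro k hk1 hk2 hk0
          rw [hstUo k hk1 hk2, hgGo k hk0]
          by_cases hsk : st k = k
          · rw [if_pos hsk, if_pos hsk]
          · rw [if_neg hsk, if_neg hsk, hgGo (st k) (hoff k hk1 hk2 hk0)]
        have hm_of : 0 < aG s₀ → 0 < m := fun h => by rw [haG0] at h; omega
        have hcases : ∀ k, 0 < aG k → k = s₀ ∨ (k ≠ ℓ₁ ∧ k ≠ ℓ₂ ∧ k ≠ s₀ ∧ 0 < a k) := by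
          intro k hk
          by_cases hk0 : k = s₀
          · exact Or.inl hk0
          by_cases hk1 : k = ℓ₁
          · rw [hk1, haG1] at hk; exact absurd hk (lt_irrefl 0)
          by_cases hk2 : k = ℓ₂
          · rw [hk2, haG2] at hk; exact absurd hk (lt_irrefl 0)
          rw [haGo k hk1 hk2 hk0] at hk
          exact Or.inr ⟨hk1, hk2, hk0, hk⟩
        refine ih aG gG stU hcardU hgG' hstemU hlvstU (fun k hk => ?_) (fun k hk => ?_) (fun k hk => ?_) ?_
        · obtain ⟨hk1, hk2, hk0, hsk, hstk, hsk0, hfibU⟩ := hleafU k hk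
          rw [hsk, hgGo k hk0, hgGo (st k) hsk0, haGo k hk1 hk2 hk0, haGo (st k) (hnl1 k) (hnl2 k) hsk0]
          rcases hunit k hstk with ⟨ha0', k', hk'k, hk's, hst', ha', hfib'⟩ | ⟨hp', hak, hl', hfib'⟩
          · have hk'1 : k' ≠ ℓ₁ := fun h => hsk0 (by rw [← hst', h, hst1])
            have hk'2 : k' ≠ ℓ₂ := fun h => hsk0 (by rw [← hst', h, hst2])
            have hk'0 : k' ≠ s₀ := fun h => hsk0 (by rw [← hst', h, hst0])
            refine Or.inl ⟨ha0', k', hk'k, hk's, by rw [hstUo k' hk'1 hk'2, hst'], by rw [haGo k' hk'1 hk'2 hk'0]; exact ha',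
              fun k'' hk'' => hfib' k'' (hfibU k'' hk'').2.2⟩
          · exact Or.inr ⟨hp', hak, hl', fun k'' hk'' => hfib' k'' (hfibU k'' hk'').2.2⟩
        · rcases hcases k hk with hk0 | ⟨-, -, -, hk'⟩
          · rw [hk0] at hk ⊢; rw [← hlv1]; exact hlv ℓ₁ (by rw [ha1]; exact hm_of hk)
          · exact hlv k hk'
        · rcases hcases k hk with hk0 | ⟨hk1, hk2, hk0, hk'⟩
          · rw [hk0] at hk ⊢
            have hm := hm_of hk
            have hx1 := hxℓ₁ (by rw [ha1]; exact hm)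
            have hx2 := hxℓ₂ (by rw [ha2]; exact hm)
            rw [if_pos hstU0, hgG0]
            have e : (∏ i ∈ Finset.range (lv s₀), q i) * (g s₀ * (g ℓ₁ + g ℓ₂) / 2) =
                ((∏ i ∈ Finset.range (lv s₀), q i) * (g s₀ * g ℓ₁) + (∏ i ∈ Finset.range (lv s₀), q i) * (g s₀ * g ℓ₂)) / 2 := by
              ring
            rw [e]
            linarith
          · rw [hfac k hk1 hk2 hk0]; exact hx k hk'
        · have hsum : (∑ k, (aG k : ℝ) * ((∏ i ∈ Finset.range (lv k), q i) * (if stU k = k then gG k else gG (stU k) * gG k))) =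
              ∑ k, (a k : ℝ) * ((∏ i ∈ Finset.range (lv k), q i) * (if st k = k then g k else g (st k) * g k)) := by
            refine sum_congr_off_three _ _ ℓ₁ ℓ₂ s₀ h12 h1.symm h2.symm (fun k hk1 hk2 hk0 => ?_) ?_
            · rw [haGo k hk1 hk2 hk0, hfac k hk1 hk2 hk0]
            · rw [haG1, haG2, haG0, if_pos hstU0, hgG0, ha1, ha2, ha0, if_neg hℓ₁, if_neg (fun h => h2 (hst2.symm.trans h)), hst1,
                hst2, hlv1, hlv2]
              push_cast
              ring
          rw [hsum]
          exact hmean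
    · ------------------------------------------------------------------ light hair (s₀; ℓ₁)
      rw [hst1] at hp hlight hfib
      obtain ⟨p, ha0⟩ : ∃ p, a s₀ = p := ⟨_, rfl⟩
      obtain ⟨r, ha1⟩ : ∃ r, a ℓ₁ = r := ⟨_, rfl⟩
      rw [ha0] at hp hlight
      rw [ha1] at hlight
      have hstep := min_tail_top_glue_le_tail D q lv a g st s₀ ℓ₁ p r h1 hst0 hst1 hfib hnl1 ha0 ha1 hlv1 hp hg1 j
      obtain ⟨hstD1, hstD0, hstDo, -, -⟩ := deadLeaf_facts st s₀ ℓ₁ h1 hst0 hfib hnl1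
      set stD := Function.update st ℓ₁ ℓ₁ with hstD
      have hcardD : (Finset.univ.filter fun k => stD k ≠ k).card ≤ n :=
        hcard_of stD hstD1 fun k hk1 hk => by rwa [hstDo k hk1] at hk
      have hstemD : ∀ k, stD (stD k) = stD k := fun k => by
        by_cases hk1 : k = ℓ₁; · rw [hk1, hstD1, hstD1]
        rw [hstDo k hk1, hstDo (st k) (hnl1 k), hstem k]
      have hlvstD : ∀ k, lv (stD k) = lv k := fun k => by
        by_cases hk1 : k = ℓ₁; · rw [hk1, hstD1]
        rw [hstDo k hk1]; exact hlvst k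
      have hoff : ∀ k, k ≠ ℓ₁ → k ≠ s₀ → st k ≠ s₀ := fun k hk1 hk0 h => by
        rcases hfib k h with h' | h'
        exacts [hk0 h', hk1 h']
      have hp' : (0 : ℝ) < p := by exact_mod_cast hp
      have hxs₀ : x ≤ (∏ i ∈ Finset.range (lv s₀), q i) * g s₀ := by
        have := hx s₀ (by rw [ha0]; exact hp); rwa [if_pos hst0] at this
      have hcw0 : 0 ≤ ∏ i ∈ Finset.range (lv s₀), q i := Finset.prod_nonneg fun i _ => (hq i).1
      -- both dead-leaf models (stem re-sized to `P`, re-gated to `γ`) satisfy the induction hypothesis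
      have hdead : ∀ (P : ℕ) (γ : ℝ), 0 < P → 0 ≤ γ → γ ≤ 1 → x ≤ (∏ i ∈ Finset.range (lv s₀), q i) * γ →
          (P : ℝ) * γ = g s₀ * (p + g ℓ₁ * r) →
          x ≤ TAILst[D, q, lv, (Function.update (Function.update a s₀ P) ℓ₁ 0), (Function.update g s₀ γ), stD, j] := by
        intro P γ hP hγ0 hγ1 hxγ hPγ
        set aD := Function.update (Function.update a s₀ P) ℓ₁ 0 with haD
        set gD := Function.update g s₀ γ with hgD
        have hgD0 : gD s₀ = γ := by rw [hgD, Function.update_self]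
        have hgDo : ∀ k, k ≠ s₀ → gD k = g k := fun k hk => by rw [hgD, Function.update_of_ne hk]
        have haD0 : aD s₀ = P := by rw [haD, Function.update_of_ne h1, Function.update_self]
        have haD1 : aD ℓ₁ = 0 := by rw [haD, Function.update_self]
        have haDo : ∀ k, k ≠ ℓ₁ → k ≠ s₀ → aD k = a k := fun k hk1 hk0 => by
          rw [haD, Function.update_of_ne hk1, Function.update_of_ne hk0]
        have hgD' : ∀ k, 0 ≤ gD k ∧ gD k ≤ 1 := by
          intro k
          by_cases hk0 : k = s₀
          · rw [hk0, hgD0]; exact ⟨hγ0, hγ1⟩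
          rw [hgDo k hk0]; exact hg k
        have hfac : ∀ k, k ≠ ℓ₁ → k ≠ s₀ →
            (if stD k = k then gD k else gD (stD k) * gD k) = (if st k = k then g k else g (st k) * g k) := by
          intro k hk1 hk0
          rw [hstDo k hk1, hgDo k hk0]
          by_cases hsk : st k = k
          · rw [if_pos hsk, if_pos hsk]
          · rw [if_neg hsk, if_neg hsk, hgDo (st k) (hoff k hk1 hk0)]
        have hcases : ∀ k, 0 < aD k → k = s₀ ∨ (k ≠ ℓ₁ ∧ k ≠ s₀ ∧ 0 < a k) := by
          intro k hk
          by_cases hk0 : k = s₀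
          · exact Or.inl hk0
          by_cases hk1 : k = ℓ₁
          · rw [hk1, haD1] at hk; exact absurd hk (lt_irrefl 0)
          rw [haDo k hk1 hk0] at hk
          exact Or.inr ⟨hk1, hk0, hk⟩
        refine ih aD gD stD hcardD hgD' hstemD hlvstD (fun k hk => ?_) (fun k hk => ?_) (fun k hk => ?_) ?_
        · have hk1 : k ≠ ℓ₁ := fun h => hk (by rw [h, hstD1])
          have hsk : stD k = st k := hstDo k hk1
          have hstk : st k ≠ k := fun h => hk (by rw [hsk, h])
          have hk0 : k ≠ s₀ := fun h => hstk (by rw [h, hst0])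
          have hsk0 : st k ≠ s₀ := hoff k hk1 hk0
          have hfibD : ∀ k'', stD k'' = st k → st k'' = st k := by
            intro k'' hk''
            have hk''1 : k'' ≠ ℓ₁ := fun h => hnl1 k (by rw [← hk'', h, hstD1])
            rwa [hstDo k'' hk''1] at hk''
          rw [hsk, hgDo k hk0, hgDo (st k) hsk0, haDo k hk1 hk0, haDo (st k) (hnl1 k) hsk0]
          rcases hunit k hstk with ⟨ha0', k', hk'k, hk's, hst', ha', hfib'⟩ | ⟨hp'', hak, hl', hfib'⟩
          · have hk'1 : k' ≠ ℓ₁ := fun h => hsk0 (by rw [← hst', h, hst1])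
            have hk'0 : k' ≠ s₀ := fun h => hsk0 (by rw [← hst', h, hst0])
            exact Or.inl ⟨ha0', k', hk'k, hk's, by rw [hstDo k' hk'1, hst'], by rw [haDo k' hk'1 hk'0]; exact ha',
              fun k'' hk'' => hfib' k'' (hfibD k'' hk'')⟩
          · exact Or.inr ⟨hp'', hak, hl', fun k'' hk'' => hfib' k'' (hfibD k'' hk'')⟩
        · rcases hcases k hk with hk0 | ⟨-, -, hk'⟩
          · rw [hk0]; exact hlv s₀ (by rw [ha0]; exact hp)
          · exact hlv k hk'
        · rcases hcases k hk with hk0 | ⟨hk1, hk0, hk'⟩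
          · rw [hk0, if_pos hstD0, hgD0]; exact hxγ
          · rw [hfac k hk1 hk0]; exact hx k hk'
        · have hsum : (∑ k, (aD k : ℝ) * ((∏ i ∈ Finset.range (lv k), q i) * (if stD k = k then gD k else gD (stD k) * gD k))) =
              ∑ k, (a k : ℝ) * ((∏ i ∈ Finset.range (lv k), q i) * (if st k = k then g k else g (st k) * g k)) := by
            refine sum_congr_off_two _ _ ℓ₁ s₀ h1.symm (fun k hk1 hk0 => ?_) ?_
            · rw [haDo k hk1 hk0, hfac k hk1 hk0]
            · rw [haD1, haD0, if_pos hstD0, hgD0, ha1, ha0, if_neg hℓ₁, if_pos hst0, hst1, hlv1]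
              push_cast
              linear_combination (∏ i ∈ Finset.range (lv s₀), q i) * hPγ
          rw [hsum]
          exact hmean
      have hcr : 0 ≤ g ℓ₁ * (r : ℝ) := mul_nonneg hg1.1 (Nat.cast_nonneg r)
      have hnum0 : 0 ≤ g s₀ * ((p : ℝ) + g ℓ₁ * r) := mul_nonneg hg0.1 (by positivity)
      refine le_trans (le_min ?_ ?_) hstep
      · -- model `A`: the top class alone, gate `s(p+cr)/p ≥ s`
        refine hdead p _ hp (div_nonneg hnum0 hp'.le) ((div_le_one hp').2 hlight) ?_ (mul_div_cancel₀ _ hp'.ne' ▸ by ring)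
        have hge : g s₀ ≤ g s₀ * (p + g ℓ₁ * r) / p := by
          rw [le_div_iff₀ hp']
          nlinarith [mul_nonneg hg0.1 hcr]
        exact hxs₀.trans (mul_le_mul_of_nonneg_left hge hcw0)
      · -- model `B`: the whole hair glued, gate `s(p+cr)/(p+r) ≥ sc`
        have hpr : (0 : ℝ) < p + r := by positivity
        have hPγ : ((p + r : ℕ) : ℝ) * (g s₀ * (p + g ℓ₁ * r) / (p + r)) = g s₀ * (p + g ℓ₁ * r) := by
          push_cast; rw [mul_div_cancel₀ _ hpr.ne']
        refine hdead (p + r) _ (by omega) (div_nonneg hnum0 hpr.le) ?_ ?_ hPγ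
        · rw [div_le_one hpr]
          have h1' : (p : ℝ) + g ℓ₁ * r ≤ p + r := by nlinarith [hg1.2, (Nat.cast_nonneg r : (0 : ℝ) ≤ r)]
          nlinarith [mul_le_of_le_one_left (hp'.le.trans (le_add_of_nonneg_right hcr) ) hg0.2]
        · have hx1 := hxℓ₁ hr
          have hge : g s₀ * g ℓ₁ ≤ g s₀ * (p + g ℓ₁ * r) / (p + r) := by
            rw [le_div_iff₀ hpr]
            have : g ℓ₁ * ((p : ℝ) + r) ≤ p + g ℓ₁ * r := by nlinarith [hg1.2, hp'.le]
            nlinarith [hg0.1, this]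
          exact hx1.trans (mul_le_mul_of_nonneg_left hge hcw0)

/-- **THEOREM (THE HAIR–CHERRY-COMB ROW: FAR at every layer for every block-comb decorated with unit cherries, unit two-relay hairs and light
two-class hairs, under `EN > 2j`; canonical stemmed model).**  Chain gates `q i ∈ [0,1]`, private gates `g k ∈ [0,1]`, stems stemless and at
the level of their leaves; every leaf `k` is either in a unit cherry (stem of size `0`, exactly one partner leaf `k' ≠ k` with `a k' = a k`) or the
unique leaf of a LIGHT hair (`0 < a (st k)`, `g (st k)·(a (st k) + g k·a k) ≤ a (st k)`); live levels `≤ D`; `x ≤` every live marginal;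
`2j < Σ_k a k·marginal k`.  Then `x ≤ TAILst[D, q, lv, a, g, st, j] = P(N ≥ j+1)`. [this work] -/
theorem tail_ge_of_hairCherryComb (D : ℕ) (q : ℕ → ℝ) (hq : ∀ i, 0 ≤ q i ∧ q i ≤ 1) (lv : κ → ℕ) (a : κ → ℕ) (g : κ → ℝ)
    (hg : ∀ k, 0 ≤ g k ∧ g k ≤ 1) (st : κ → κ) (hstem : ∀ k, st (st k) = st k) (hlvst : ∀ k, lv (st k) = lv k)
    (hunit : ∀ k, st k ≠ k →
      (a (st k) = 0 ∧ ∃ k', k' ≠ k ∧ k' ≠ st k ∧ st k' = st k ∧ a k' = a k ∧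
        ∀ k'', st k'' = st k → k'' = st k ∨ k'' = k ∨ k'' = k') ∨
      (0 < a (st k) ∧ 0 < a k ∧ g (st k) * (a (st k) + g k * a k) ≤ a (st k) ∧ ∀ k'', st k'' = st k → k'' = st k ∨ k'' = k))
    (j : ℕ) (hlv : ∀ k, 0 < a k → lv k ≤ D) (x : ℝ)
    (hx : ∀ k, 0 < a k → x ≤ (∏ i ∈ Finset.range (lv k), q i) * (if st k = k then g k else g (st k) * g k))
    (hmean : (2 * j : ℝ) < ∑ k, (a k : ℝ) * ((∏ i ∈ Finset.range (lv k), q i) * (if st k = k then g k else g (st k) * g k))) :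
    x ≤ TAILst[D, q, lv, a, g, st, j] :=
  tail_ge_of_hairCherryComb_aux D q hq lv j x _ a g st le_rfl hg hstem hlvst hunit hlv hx hmean

end CherryComb

end Quant

end Summit.CriticalPhenomena.PercolationContinuityZ3.Theorems
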